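import Summits.HodgeConjecture.HodgeConjecture.Theorems.NikulinTwinTransportTwinSimilitudeAlgebraicMarkings
import Literature.AlgebraicGeometry.Surfaces.K3HodgeTypesProofs

/-!
# Route NikulinTwinTransport · `RealMultiplicationGlue` (stmt-HodgeConjecture-13681) —
# the Hodge types of `H²(K3)` read off a type-preserving endomorphism

Lemmas removing the named fact `Huybrechts_K3_hodgeTypes_H2` (Huybrechts Ch. 6 Prop. 1.2:
`H^{1,1} = ⟨σ, σ̄⟩^⊥`) from the `(1,1)`-bookkeeping of the glue item `RealMultiplicationGlue`
(sibling file `NikulinTwinTransportRealMultiplicationGlueOfMarking`). Only the two LINES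
`H^{2,0} = ℂσ`, `H^{0,2} = ℂσ̄` (a clause of the marking fact and its conjugate,
`isOfHodgeType_swap_iff_of_line`) and the uniqueness of the Hodge decomposition of a Hodge model
(field `HodgeModel.isInternal_hodgePQ`) are used — no statement about cup products of types
(`CupPreservesHodgeType`, de Rham's theorem in multiplicative form) enters:

* `hodgeModel_eq_zero_of_add_add_eq_zero` — a class of two Hodge types is zero, three-term form;
* `exists_eq_lines_add_oneOne` — every class of `H²` is `aσ + y₁₁ + bσ̄`, `y₁₁` of type `(1,1)`;
* `isOfHodgeType_oneOne_of_ker` — for a type-preserving `e` acting on the two lines by NON-ZERO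
  scalars, `ker e ⊆ H^{1,1}`; for real multiplication on a K3 surface (`e|_{NS} = 0`, `eσ = λσ`,
  `λ ≠ 0`) the divisor classes are therefore of type `(1,1)`;
* `isOfHodgeType_add_correction_of_oneOne` — the corrected endomorphism `Ξ = e + ν̃`,
  `ν̃ = Σᵢ (η·.aᵢ) η⁻¹bᵢ`, preserves every Hodge type as soon as the `aᵢ` are orthogonal to `x₀, x̄₀`
  and the `η⁻¹bᵢ` are of type `(1,1)` (replacing `isOfHodgeType_add_correction`).

Sources: Voisin, *Hodge Theory I*, Thm. 6.18, Cor. 6.12, Cor. 6.14; Huybrechts, *Lectures on K3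
Surfaces*, Ch. 3 Def. 2.3. Prover seat prover-pitem-stmt-HodgeConjecture-13681-1.
-/

noncomputable section

namespace Summit.HodgeConjecture.HodgeConjecture.Theorems.NikulinTwinTransport

open scoped Manifold
open CategoryTheory MonoidalCategory
open Literature.AlgebraicGeometry.Motives Literature.AlgebraicGeometry.HodgeTheory
open Literature.AlgebraicGeometry.Surfaces Literature.Geometry.Kaehler
open Literature.AlgebraicTopology.SingularHomology

/-! ### Independence of the pieces of the Hodge decomposition: three-term form -/

/-- For an independent family of submodules, if `u + v + w = 0` with `u ∈ T i`, `v ∈ T j`,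
`w ∈ T l` and `j, l ≠ i`, then `u = 0` (`u = −(v + w) ∈ T i ⊓ ⨆_{m ≠ i} T m = ⊥`). [folklore] -/
theorem eq_zero_of_add_add_eq_zero_of_iSupIndep {R V ι : Type*} [Ring R] [AddCommGroup V]
    [Module R V] {T : ι → Submodule R V} (hT : iSupIndep T) {i j l : ι} (hji : j ≠ i) (hli : l ≠ i)
    {u v w : V} (hu : u ∈ T i) (hv : v ∈ T j) (hw : w ∈ T l) (h : u + v + w = 0) : u = 0 := by
  have hdisj := hT i
  rw [Submodule.disjoint_def] at hdisj
  refine hdisj u hu ?_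
  have hu' : u = -(v + w) := by
    rw [eq_neg_iff_add_eq_zero, ← add_assoc]
    exact h
  rw [hu']
  refine Submodule.neg_mem _ (Submodule.add_mem _ ?_ ?_)
  · exact (le_iSup₂_of_le (f := fun (m : ι) (_ : m ≠ i) => T m) j hji le_rfl) hv
  · exact (le_iSup₂_of_le (f := fun (m : ι) (_ : m ≠ i) => T m) l hli le_rfl) hw

/-- **A class of two Hodge types is zero, three-term form.** In a Hodge model `A` of `X`: if
`u + v + w = 0` in `Hᵏ(X(ℂ); ℂ)` with `A^*u ∈ H^{i}`, `A^*v ∈ H^{j}`, `A^*w ∈ H^{l}` for bidegrees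
`j, l ≠ i` of total degree `k`, then `u = 0` — the pieces `H^{p,q}`, `p + q = k`, are independent
(field `HodgeModel.isInternal_hodgePQ`, transported along the de Rham comparison) and `A^*` is
injective. [cite: VoisinHodgeI2002, Thm. 6.18 and Cor. 6.14] -/
theorem hodgeModel_eq_zero_of_add_add_eq_zero {n : ℕ} {X : SchemeOver ℂ} (A : HodgeModel n X)
    {k : ℕ} {i j l : ℕ × ℕ} (hi : i ∈ Finset.HasAntidiagonal.antidiagonal k)
    (hj : j ∈ Finset.HasAntidiagonal.antidiagonal k) (hl : l ∈ Finset.HasAntidiagonal.antidiagonal k)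
    (hji : j ≠ i) (hli : l ≠ i) {u v w : complexBetti X k}
    (hu : A.pullback k u ∈ A.hodgePQ k i.1 i.2) (hv : A.pullback k v ∈ A.hodgePQ k j.1 j.2)
    (hw : A.pullback k w ∈ A.hodgePQ k l.1 l.2) (h : u + v + w = 0) : u = 0 := by
  have hind : iSupIndep fun pq : ↥(Finset.HasAntidiagonal.antidiagonal k) => A.hodgePQ k pq.1.1 pq.1.2 :=
    (iSupIndep_map_orderIso_iff (Submodule.orderIsoMapComap (A.deRham A.carrier k))).2
      (A.isInternal_hodgePQ k).submodule_iSupIndep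
  have hsum : A.pullback k u + A.pullback k v + A.pullback k w = 0 := by
    rw [← map_add, ← map_add, h, map_zero]
  have hu0 : A.pullback k u = 0 :=
    eq_zero_of_add_add_eq_zero_of_iSupIndep hind (i := ⟨i, hi⟩) (j := ⟨j, hj⟩) (l := ⟨l, hl⟩)
      (fun h' => hji (congrArg Subtype.val h')) (fun h' => hli (congrArg Subtype.val h')) hu hv hw hsum
  exact A.pullback_injective k (by rw [hu0, map_zero])

section Marked

variable {S : SchemeOver ℂ}

/-! ### The Hodge decomposition of `H²(S)` through the two lines -/

/-- **`y = aσ + y₁₁ + bσ̄`.** On a smooth projective surface whose `(2,0)`-classes form the line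
`ℂσ` (so that the `(0,2)`-classes form `ℂσ̄`, `isOfHodgeType_swap_iff_of_line`), every class of
`H²` is `aσ + y₁₁ + bσ̄` with `y₁₁` of type `(1,1)` (Hodge decomposition of a model,
`HodgeModel.exists_sum_eq_of_hodgeDecomposition`). [cite: VoisinHodgeI2002, §6.1.3 and Cor. 6.12]
[cite: Huybrechts2016K3, Ch. 3 Def. 2.3] -/
theorem exists_eq_lines_add_oneOne (hS : IsSmoothProjective 2 S) (A : HodgeModel 2 S)
    {σ σ' : complexBetti S (2 * 1)}
    (h1 : ∀ c : complexBetti S (2 * 1), IsOfHodgeType 2 S (2 * 1) 2 0 c ↔ ∃ t : ℂ, c = t • σ)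
    (h2 : ∀ c : complexBetti S (2 * 1), IsOfHodgeType 2 S (2 * 1) 0 2 c ↔ ∃ t : ℂ, c = t • σ')
    (y : complexBetti S (2 * 1)) :
    ∃ (a b : ℂ) (y₁₁ : complexBetti S (2 * 1)), IsOfHodgeType 2 S (2 * 1) 1 1 y₁₁ ∧
      y = a • σ + y₁₁ + b • σ' := by
  have _ := hS
  obtain ⟨z, hzc, hz⟩ := A.exists_sum_eq_of_hodgeDecomposition (2 * 1) y
  have hz' : ∀ i ∈ Finset.HasAntidiagonal.antidiagonal (2 * 1),
      IsOfHodgeType 2 S (2 * 1) i.1 i.2 (z i) := fun i hi => ⟨A, hz i hi⟩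
  obtain ⟨a, ha⟩ := (h1 _).1 (hz' (2, 0) (by simp))
  obtain ⟨b, hb⟩ := (h2 _).1 (hz' (0, 2) (by simp))
  refine ⟨a, b, z (1, 1), hz' (1, 1) (by simp), ?_⟩
  rw [← hzc, sum_antidiagonal_two_mul_one, ha, hb]
  abel

/-- **Classes killed by `e` are of type `(1,1)` when `e` is injective on the two lines.** For a
type-preserving endomorphism `e` of `H²(S)` with `eσ = lσ`, `eσ̄ = l'σ̄`, `l, l' ≠ 0` (the two
lines as in `exists_eq_lines_add_oneOne`): if `e d = 0` then `d` is of type `(1,1)` — write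
`d = aσ + d₁₁ + bσ̄`, so `0 = (al)σ + e d₁₁ + (bl')σ̄` with summands of types `(2,0), (1,1), (0,2)`,
whence `al = bl' = 0` (`hodgeModel_eq_zero_of_add_add_eq_zero`). For a K3 surface with real
multiplication `e` (`e|_{NS} = 0`): the divisor classes are of type `(1,1)`, with no appeal to the
bigrading of the cup product. [cite: VoisinHodgeI2002, Cor. 6.14] [cite: Huybrechts2016K3, Ch. 3 §3.2] -/
theorem isOfHodgeType_oneOne_of_ker (hS : IsSmoothProjective 2 S) (A : HodgeModel 2 S)
    {σ σ' : complexBetti S (2 * 1)} (hσ : IsOfHodgeType 2 S (2 * 1) 2 0 σ) (hσ0 : σ ≠ 0)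
    (hσ' : IsOfHodgeType 2 S (2 * 1) 0 2 σ') (hσ'0 : σ' ≠ 0)
    (h1 : ∀ c : complexBetti S (2 * 1), IsOfHodgeType 2 S (2 * 1) 2 0 c ↔ ∃ t : ℂ, c = t • σ)
    (h2 : ∀ c : complexBetti S (2 * 1), IsOfHodgeType 2 S (2 * 1) 0 2 c ↔ ∃ t : ℂ, c = t • σ')
    (e : complexBetti S (2 * 1) →ₗ[ℂ] complexBetti S (2 * 1))
    (he_type : ∀ (i j : ℕ) x, IsOfHodgeType 2 S (2 * 1) i j x → IsOfHodgeType 2 S (2 * 1) i j (e x))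
    {l l' : ℂ} (hl : e σ = l • σ) (hl' : e σ' = l' • σ') (hl0 : l ≠ 0) (hl'0 : l' ≠ 0)
    {d : complexBetti S (2 * 1)} (hd : e d = 0) : IsOfHodgeType 2 S (2 * 1) 1 1 d := by
  obtain ⟨a, b, d₁₁, hd₁₁, hdeq⟩ := exists_eq_lines_add_oneOne hS A h1 h2 d
  have hsum : (a * l) • σ + e d₁₁ + (b * l') • σ' = 0 := by
    rw [hdeq, map_add, map_add, map_smul, map_smul, hl, hl', smul_smul, smul_smul] at hd
    exact hd
  have h20 : (2, 0) ∈ Finset.HasAntidiagonal.antidiagonal (2 * 1) := by simp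
  have h11 : (1, 1) ∈ Finset.HasAntidiagonal.antidiagonal (2 * 1) := by simp
  have h02 : (0, 2) ∈ Finset.HasAntidiagonal.antidiagonal (2 * 1) := by simp
  have hu : A.pullback (2 * 1) ((a * l) • σ) ∈ A.hodgePQ (2 * 1) 2 0 := (hσ.smul _).mem_hodgePQ hS A
  have hv : A.pullback (2 * 1) (e d₁₁) ∈ A.hodgePQ (2 * 1) 1 1 := (he_type 1 1 _ hd₁₁).mem_hodgePQ hS A
  have hw : A.pullback (2 * 1) ((b * l') • σ') ∈ A.hodgePQ (2 * 1) 0 2 := (hσ'.smul _).mem_hodgePQ hS A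
  have ha0 : (a * l) • σ = 0 :=
    hodgeModel_eq_zero_of_add_add_eq_zero A (i := (2, 0)) (j := (1, 1)) (l := (0, 2)) h20 h11 h02
      (by decide) (by decide) hu hv hw hsum
  have hb0 : (b * l') • σ' = 0 :=
    hodgeModel_eq_zero_of_add_add_eq_zero A (i := (0, 2)) (j := (2, 0)) (l := (1, 1)) h02 h20 h11
      (by decide) (by decide) hw hu hv (by rw [← hsum]; abel)
  have ha : a = 0 := by
    rcases smul_eq_zero.1 ha0 with h | h
    · exact (mul_eq_zero.1 h).resolve_right hl0
    · exact absurd h hσ0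
  have hb : b = 0 := by
    rcases smul_eq_zero.1 hb0 with h | h
    · exact (mul_eq_zero.1 h).resolve_right hl'0
    · exact absurd h hσ'0
  rw [hdeq, ha, hb, zero_smul, zero_smul, zero_add, add_zero]
  exact hd₁₁

/-! ### Type preservation of `Ξ = e + ν̃` from the `(1,1)`-type of the correction classes -/

/-- **`Ξ = e + ν̃` preserves every Hodge type**, granted only the two lines `H^{2,0} = ℂσ`,
`H^{0,2} = ℂσ̄` (`σ = η⁻¹x₀`, `σ̄ = η⁻¹x̄₀`), that the classes `aᵢ` of the correction
`ν̃ = Σᵢ (η·.aᵢ) η⁻¹bᵢ` are orthogonal to `x₀, x̄₀` (so `ν̃σ = ν̃σ̄ = 0`) and that the classes `η⁻¹bᵢ`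
are of type `(1,1)` (so `ν̃` takes `(1,1)`-values; `IsOfHodgeType.add/.sum`, unconditional in the
tree). Replaces `isOfHodgeType_add_correction`, which read `H^{1,1} = ⟨σ, σ̄⟩^⊥` from
`Huybrechts_K3_hodgeTypes_H2`. [cite: Huybrechts2016K3, Ch. 6 Prop. 1.2] [cite: VoisinHodgeI2002, §7.1.1] -/
theorem isOfHodgeType_add_correction_of_oneOne (hS : IsK3Surface S)
    (η : complexBetti S (2 * 1) ≃ₗ[ℂ] (K3Index → ℂ)) (x₀ : K3Index → ℂ)
    (h1 : ∀ c : complexBetti S (2 * 1), IsOfHodgeType 2 S (2 * 1) 2 0 c ↔ ∃ t : ℂ, c = t • η.symm x₀)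
    (h2 : ∀ c : complexBetti S (2 * 1),
      IsOfHodgeType 2 S (2 * 1) 0 2 c ↔ ∃ t : ℂ, c = t • η.symm (star x₀))
    (e ν : complexBetti S (2 * 1) →ₗ[ℂ] complexBetti S (2 * 1))
    (he_type : ∀ (i j : ℕ) x, IsOfHodgeType 2 S (2 * 1) i j x → IsOfHodgeType 2 S (2 * 1) i j (e x))
    {m : ℕ} (a b : Fin m → K3Index → ℚ)
    (hν : ∀ x, ν x = ∑ i, k3Form (η x) (fun j => (a i j : ℂ)) • η.symm (fun j => (b i j : ℂ)))
    (ha : ∀ i, k3Form (fun j => (a i j : ℂ)) x₀ = 0 ∧ k3Form (fun j => (a i j : ℂ)) (star x₀) = 0)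
    (hb : ∀ i, IsOfHodgeType 2 S (2 * 1) 1 1 (η.symm fun j => (b i j : ℂ))) :
    ∀ (i j : ℕ) (y : complexBetti S (2 * 1)),
      IsOfHodgeType 2 S (2 * 1) i j y → IsOfHodgeType 2 S (2 * 1) i j ((e + ν) y) := by
  obtain ⟨A⟩ := hS.nonempty_hodgeModel
  have hν0 : ν (η.symm x₀) = 0 := by
    rw [hν, LinearEquiv.apply_symm_apply]
    refine Finset.sum_eq_zero fun i _ => ?_
    rw [k3Form_comm, (ha i).1, zero_smul]
  have hν0' : ν (η.symm (star x₀)) = 0 := by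
    rw [hν, LinearEquiv.apply_symm_apply]
    refine Finset.sum_eq_zero fun i _ => ?_
    rw [k3Form_comm, (ha i).2, zero_smul]
  intro i j y hy
  by_cases hij : i + j = 2 * 1
  · obtain ⟨rfl, rfl⟩ | ⟨rfl, rfl⟩ | ⟨rfl, rfl⟩ :
        (i = 2 ∧ j = 0) ∨ (i = 0 ∧ j = 2) ∨ (i = 1 ∧ j = 1) := by omega
    · obtain ⟨t, ht⟩ := (h1 y).1 hy
      rw [LinearMap.add_apply, show ν y = 0 by rw [ht, map_smul, hν0, smul_zero], add_zero]
      exact he_type 2 0 y hy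
    · obtain ⟨t, ht⟩ := (h2 y).1 hy
      rw [LinearMap.add_apply, show ν y = 0 by rw [ht, map_smul, hν0', smul_zero], add_zero]
      exact he_type 0 2 y hy
    · rw [LinearMap.add_apply, hν]
      exact (he_type 1 1 y hy).add hS.1
        (IsOfHodgeType.sum hS.1 A Finset.univ _ fun k _ => (hb k).smul _)
  · obtain rfl := isOfHodgeType_eq_zero_of_add_ne hy hij
    rw [map_zero]
    exact IsOfHodgeType.zero A _ _ _

end Marked

end Summit.HodgeConjecture.HodgeConjecture.Theorems.NikulinTwinTransport

end
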